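import Mathlib
import Literature.Analysis.ODE.InverseSquareLadder
import Literature.Analysis.ODE.InverseSquareLadderMonomials
import Literature.Analysis.ODE.InverseSquareLadderAsymptotics
import HarnessLib

/-!
# The kernel of the Darboux ladder on an interval: odd polynomials of degree `< 2n`

Analysis/ODE support file (everything proved, no definitions). Let `ι` be smooth with `ι = x⁻¹` on
`[½, ∞)` and let `f ∈ Cⁿ` satisfy `ladder ι n f = 0` on an open interval `J = (α, β)`, `α ≥ ½`.
Then on `J` the function `f` is an ODD polynomial of degree `< 2n`:
`f = Σ_{j<n} c_j x^{2j+1}` (`exists_polynomial_of_ladder_eq_zero`, stated with a polynomial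
`p ∈ ℝ[X]` all of whose even coefficients and all of whose coefficients of index `≥ 2n` vanish).
Proof by induction on `n`: the top rung `(∂ − (n+1)/x)(ladder ι n f) = 0` forces
`ladder ι n f = C x^{n+1}` on `J` (the quotient by `x^{n+1}` has zero derivative; mean value
theorem), `x^{2n+1}` is a pre-image of `Π_{l<n}(2n−2l) x^{n+1}` (`ladder_pow_eq`), and the
induction hypothesis applies to `f − (C/Π) x^{2n+1}`. Converse: `ladder_polynomial_eq_zero`
(`LadderGap.lean`). This identifies the pre-images, on the gap, of Cauchy data supported off a ball
in the exact inverse-square channel identity (Kenig–Lawrie–Liu–Schlag 2015, §2; route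
PhotonSphereChannels, `WindowedShellChannels`, stmt-FinalStateConjecture-14085, far side). Folklore.
-/

noncomputable section

namespace Literature.Analysis.ODE

open Set Filter Topology Finset Real Polynomial MeasureTheory

variable {ι : ℝ → ℝ}

/-- The ladder coefficient of `x^{2n+1}` at level `n` is positive:
`Π_{l<n} ((2n+1) − 2l − 1) = Π_{l<n} 2(n − l) > 0`. [folklore] -/
theorem ladderCoeff_pos (n : ℕ) : 0 < ∏ k ∈ range n, (((2 * n + 1 : ℕ) : ℝ) - 2 * k - 1) := by
  refine Finset.prod_pos fun k hk => ?_
  have hk' : k < n := mem_range.1 hk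
  have : ((k : ℝ)) + 1 ≤ n := by exact_mod_cast hk'
  push_cast
  linarith

/-- A `C¹` function `u` with `u' = (n+1) u / x` on an open interval `J ⊆ (0,∞)` is a multiple of
`x^{n+1}` there. [folklore] -/
theorem eq_const_mul_pow_of_deriv_eq {u : ℝ → ℝ} (hu : Differentiable ℝ u) {n : ℕ} {α β : ℝ}
    (hα : 0 < α) (h : ∀ x ∈ Ioo α β, deriv u x = (n + 1) * x⁻¹ * u x) :
    ∃ C : ℝ, ∀ x ∈ Ioo α β, u x = C * x ^ (n + 1) := by
  rcases le_or_gt β α with hβ | hβ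
  · exact ⟨0, fun x hx => absurd (hx.1.trans hx.2) (not_lt.2 hβ)⟩
  set v : ℝ → ℝ := fun x => u x / x ^ (n + 1) with hv
  -- `v' = 0` on `J`
  have hv' : ∀ x ∈ Ioo α β, HasDerivAt v 0 x := by
    intro x hx
    have hx0 : 0 < x := hα.trans hx.1
    have hxp : x ^ (n + 1) ≠ 0 := pow_ne_zero _ hx0.ne'
    have h1 : HasDerivAt u (deriv u x) x := (hu x).hasDerivAt
    have h2 : HasDerivAt (fun y : ℝ => y ^ (n + 1)) (((n + 1 : ℕ) : ℝ) * x ^ n) x := by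
      simpa using hasDerivAt_pow (n + 1) x
    have h3 := h1.div h2 hxp
    refine h3.congr_deriv ?_
    rw [h x hx]
    field_simp
    push_cast
    ring
  have hvd : ∀ x ∈ Ioo α β, DifferentiableAt ℝ v x := fun x hx => (hv' x hx).differentiableAt
  -- `v` is constant on `J` (mean value theorem)
  set x₀ : ℝ := (α + β) / 2 with hx₀
  have hx₀J : x₀ ∈ Ioo α β := ⟨by rw [hx₀]; linarith, by rw [hx₀]; linarith⟩
  have hconst : ∀ y ∈ Ioo α β, v y = v x₀ := by
    intro y hy
    rcases lt_trichotomy y x₀ with hlt | heq | hgt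
    · have hsub : Icc y x₀ ⊆ Ioo α β := fun z hz => ⟨lt_of_lt_of_le hy.1 hz.1, lt_of_le_of_lt hz.2 hx₀J.2⟩
      obtain ⟨c, hc, hcd⟩ := exists_deriv_eq_slope v hlt
        (fun z hz => (hvd z (hsub hz)).continuousAt.continuousWithinAt)
        (fun z hz => (hvd z (hsub (Ioo_subset_Icc_self hz))).differentiableWithinAt)
      have : deriv v c = 0 := (hv' c (hsub (Ioo_subset_Icc_self hc))).deriv
      rw [this] at hcd
      have hne : x₀ - y ≠ 0 := by linarith
      have := hcd.symm
      rw [div_eq_zero_iff] at this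
      rcases this with h0 | h0
      · linarith
      · exact absurd h0 hne
    · rw [heq]
    · have hsub : Icc x₀ y ⊆ Ioo α β := fun z hz => ⟨lt_of_lt_of_le hx₀J.1 hz.1, lt_of_le_of_lt hz.2 hy.2⟩
      obtain ⟨c, hc, hcd⟩ := exists_deriv_eq_slope v hgt
        (fun z hz => (hvd z (hsub hz)).continuousAt.continuousWithinAt)
        (fun z hz => (hvd z (hsub (Ioo_subset_Icc_self hz))).differentiableWithinAt)
      have : deriv v c = 0 := (hv' c (hsub (Ioo_subset_Icc_self hc))).deriv
      rw [this] at hcd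
      have hne : y - x₀ ≠ 0 := by linarith
      have := hcd.symm
      rw [div_eq_zero_iff] at this
      rcases this with h0 | h0
      · linarith
      · exact absurd h0 hne
  refine ⟨v x₀, fun x hx => ?_⟩
  have hx0 : 0 < x := hα.trans hx.1
  have hxp : x ^ (n + 1) ≠ 0 := pow_ne_zero _ hx0.ne'
  have hc := hconst x hx
  have hvx : v x = u x / x ^ (n + 1) := rfl
  rw [← hc, hvx]
  field_simp

/-- **The kernel of the ladder on an interval consists of odd polynomials of degree `< 2n`.**
See the module docstring. [cite: KenigEtAl2015, §2] -/
theorem exists_polynomial_of_ladder_eq_zero (hι : ContDiff ℝ (⊤ : ℕ∞) ι)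
    (hιeq : ∀ x : ℝ, 1 / 2 ≤ x → ι x = x⁻¹) :
    ∀ (n : ℕ) {f : ℝ → ℝ}, ContDiff ℝ n f → ∀ {α β : ℝ}, 1 / 2 ≤ α →
      (∀ x ∈ Ioo α β, ladder ι n f x = 0) →
      ∃ p : ℝ[X], (∀ i, Even i → p.coeff i = 0) ∧ (∀ i, 2 * n ≤ i → p.coeff i = 0) ∧
        ∀ x ∈ Ioo α β, f x = p.eval x := by
  intro n
  induction n with
  | zero =>
    intro f _ α β _ h0
    refine ⟨0, fun i _ => by simp, fun i _ => by simp, fun x hx => ?_⟩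
    simpa using h0 x hx
  | succ n ih =>
    intro f hf α β hα hlad
    have hα0 : 0 < α := by linarith
    set u : ℝ → ℝ := ladder ι n f with hu
    have huC : ContDiff ℝ 1 u := contDiff_ladder hι (m := 1) (by rw [add_comm]; exact hf)
    have hud : Differentiable ℝ u := huC.differentiable (by norm_num)
    -- the top rung: `u' = (n+1) u / x` on `J`
    have htop : ∀ x ∈ Ioo α β, deriv u x = (n + 1) * x⁻¹ * u x := by
      intro x hx
      have h := hlad x hx
      rw [ladder_succ, ladderStep_apply, hιeq x (by linarith [hx.1])] at h
      have : deriv u x = ((n + 1 : ℕ) : ℝ) * x⁻¹ * u x := by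
        have h' : deriv (ladder ι n f) x - ((n + 1 : ℕ) : ℝ) * x⁻¹ * ladder ι n f x = 0 := h
        show deriv (ladder ι n f) x = _
        linarith
      rw [this]; push_cast; ring
    obtain ⟨C, hC⟩ := eq_const_mul_pow_of_deriv_eq hud hα0 htop
    -- remove the particular solution `(C/K) x^{2n+1}`
    set K : ℝ := ∏ k ∈ range n, (((2 * n + 1 : ℕ) : ℝ) - 2 * k - 1) with hK
    have hK0 : 0 < K := ladderCoeff_pos n
    set f₁ : ℝ → ℝ := fun x => f x - (C / K) * x ^ (2 * n + 1) with hf₁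
    have hmono : ContDiff ℝ n fun x : ℝ => (C / K) * x ^ (2 * n + 1) :=
      contDiff_const.mul (contDiff_id.pow _)
    have hfn : ContDiff ℝ n f := hf.of_le (by exact_mod_cast Nat.le_succ n)
    have hf₁C : ContDiff ℝ n f₁ := hfn.sub hmono
    have hlad₁ : ∀ x ∈ Ioo α β, ladder ι n f₁ x = 0 := by
      intro x hx
      have hx' : 1 / 2 < x := by linarith [hx.1]
      have hx0 : x ≠ 0 := by intro h0; rw [h0] at hx'; norm_num at hx'
      have e1 : ladder ι n f₁ = fun y => ladder ι n f y - ladder ι n (fun z : ℝ => (C / K) * z ^ (2 * n + 1)) y := by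
        rw [hf₁]; exact ladder_sub hι hfn hmono
      have e2 : ladder ι n (fun z : ℝ => (C / K) * z ^ (2 * n + 1))
          = fun y => (C / K) * ladder ι n (fun z : ℝ => z ^ (2 * n + 1)) y :=
        ladder_const_mul n _ _
      rw [e1]
      simp only [e2]
      rw [ladder_pow_eq hιeq (2 * n + 1) n x hx', ← hK]
      have hz : x ^ (((2 * n + 1 : ℕ) : ℤ) - n) = x ^ (n + 1) := by
        have : ((2 * n + 1 : ℕ) : ℤ) - n = ((n + 1 : ℕ) : ℤ) := by push_cast; ring
        rw [this, zpow_natCast]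
      rw [hz, show ladder ι n f x = u x from rfl, hC x hx]
      field_simp
      ring
    obtain ⟨p₁, hp₁odd, hp₁deg, hp₁⟩ := ih hf₁C hα hlad₁
    refine ⟨p₁ + Polynomial.C (C / K) * X ^ (2 * n + 1), ?_, ?_, ?_⟩
    · intro i hi
      rw [coeff_add, coeff_C_mul_X_pow, hp₁odd i hi]
      have : i ≠ 2 * n + 1 := by rintro rfl; exact (Nat.not_even_iff_odd.2 (by exact ⟨n, rfl⟩)) hi
      simp [this]
    · intro i hi
      rw [coeff_add, coeff_C_mul_X_pow, hp₁deg i (by omega)]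
      have : i ≠ 2 * n + 1 := by omega
      simp [this]
    · intro x hx
      have := hp₁ x hx
      simp only [hf₁] at this
      rw [eval_add, eval_mul, eval_C, eval_pow, eval_X, ← this]
      ring

/-! ### Parity of polynomials: coefficients versus values -/

/-- Coefficients of `p(−X)`: `(p.comp (−X)).coeff i = (−1)^i p.coeff i`. [folklore] -/
theorem coeff_comp_neg_X (p : ℝ[X]) (i : ℕ) : (p.comp (-X)).coeff i = (-1) ^ i * p.coeff i := by
  have hp : p.comp (-X) = ∑ j ∈ range (p.natDegree + 1), Polynomial.C (p.coeff j * (-1) ^ j) * X ^ j := by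
    conv_lhs => rw [p.as_sum_range_C_mul_X_pow]
    rw [Polynomial.sum_comp]
    refine Finset.sum_congr rfl fun j _ => ?_
    rw [mul_comp, C_comp, X_pow_comp, neg_pow, ← mul_assoc, C_mul, C_pow, C_neg, C_1]
  rw [hp, finsetSum_coeff]
  simp only [coeff_C_mul_X_pow]
  rw [Finset.sum_eq_single i]
  · simp only [if_true]
    by_cases hi : i ∈ range (p.natDegree + 1)
    · ring
    · have : p.coeff i = 0 := by
        refine coeff_eq_zero_of_natDegree_lt ?_
        have := Finset.mem_range.not.1 hi
        omega
      simp [this]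
  · intro j _ hj; simp [Ne.symm hj]
  · intro hi
    have : p.coeff i = 0 := by
      refine coeff_eq_zero_of_natDegree_lt ?_
      have := Finset.mem_range.not.1 hi
      omega
    simp [this]

/-- An odd polynomial (even coefficients vanish) satisfies `p(−X) = −p`. [folklore] -/
theorem comp_neg_X_eq_neg_of_even_coeff {p : ℝ[X]} (hodd : ∀ i, Even i → p.coeff i = 0) :
    p.comp (-X) = -p := by
  ext i
  rw [coeff_comp_neg_X, coeff_neg]
  rcases Nat.even_or_odd i with hi | hi
  · rw [hodd i hi]; simp
  · rw [hi.neg_one_pow]; ring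

/-- An even polynomial (odd coefficients vanish) satisfies `p(−X) = p`. [folklore] -/
theorem comp_neg_X_eq_of_odd_coeff {p : ℝ[X]} (heven : ∀ i, Odd i → p.coeff i = 0) :
    p.comp (-X) = p := by
  ext i
  rw [coeff_comp_neg_X]
  rcases Nat.even_or_odd i with hi | hi
  · rw [hi.neg_one_pow]; ring
  · rw [heven i hi]; simp

/-- Values of an odd polynomial: `p(−y) = −p(y)`. [folklore] -/
theorem eval_neg_of_even_coeff {p : ℝ[X]} (hodd : ∀ i, Even i → p.coeff i = 0) (y : ℝ) :
    p.eval (-y) = -p.eval y := by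
  have h := congrArg (fun r : ℝ[X] => r.eval y) (comp_neg_X_eq_neg_of_even_coeff hodd)
  simpa [eval_comp] using h

/-- Values of an even polynomial: `p(−y) = p(y)`. [folklore] -/
theorem eval_neg_of_odd_coeff {p : ℝ[X]} (heven : ∀ i, Odd i → p.coeff i = 0) (y : ℝ) :
    p.eval (-y) = p.eval y := by
  have h := congrArg (fun r : ℝ[X] => r.eval y) (comp_neg_X_eq_of_odd_coeff heven)
  simpa [eval_comp] using h

/-- A polynomial with odd VALUES (`p(−y) = −p(y)` for all `y`) has vanishing even coefficients.
[folklore] -/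
theorem even_coeff_eq_zero_of_eval_neg {p : ℝ[X]} (h : ∀ y : ℝ, p.eval (-y) = -p.eval y) :
    ∀ i, Even i → p.coeff i = 0 := by
  have hcomp : p.comp (-X) = -p := by
    refine Polynomial.funext fun y => ?_
    simpa [eval_comp] using h y
  intro i hi
  have hc := congrArg (fun r : ℝ[X] => r.coeff i) hcomp
  simp only [coeff_comp_neg_X, coeff_neg, hi.neg_one_pow, one_mul] at hc
  linarith

/-- The derivative of an odd polynomial is even. [folklore] -/
theorem odd_coeff_derivative_eq_zero {p : ℝ[X]} (hodd : ∀ i, Even i → p.coeff i = 0) :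
    ∀ i, Odd i → (derivative p).coeff i = 0 := by
  intro i hi
  rw [coeff_derivative, hodd (i + 1) (hi.add_one), zero_mul]

/-- A **formal primitive** of a polynomial `q`: `Σ_{i ≤ deg q} (q_i/(i+1)) X^{i+1}`. Stated as an
existence result with the three properties used downstream (derivative, parity flip, degree).
[folklore] -/
theorem exists_primitive_polynomial (q : ℝ[X]) :
    ∃ Q : ℝ[X], derivative Q = q ∧ Q.natDegree ≤ q.natDegree + 1 ∧
      ((∀ i, Even i → q.coeff i = 0) → ∀ i, Odd i → Q.coeff i = 0) := by
  set Q : ℝ[X] := ∑ i ∈ range (q.natDegree + 1), Polynomial.C (q.coeff i / (i + 1)) * X ^ (i + 1)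
    with hQ
  have hcoeff : ∀ j, Q.coeff j = if j = 0 then 0 else
      (if j - 1 < q.natDegree + 1 then q.coeff (j - 1) / ((j - 1 : ℕ) + 1) else 0) := by
    intro j
    rw [hQ, finsetSum_coeff]
    simp only [coeff_C_mul_X_pow]
    rcases Nat.eq_zero_or_pos j with rfl | hj
    · simp
    · rw [if_neg hj.ne']
      rw [Finset.sum_eq_single (j - 1)]
      · have : j = j - 1 + 1 := by omega
        simp only [← this, if_true]
        by_cases hlt : j - 1 < q.natDegree + 1
        · rw [if_pos hlt]
        · rw [if_neg hlt]
          have : q.coeff (j - 1) = 0 := coeff_eq_zero_of_natDegree_lt (by omega)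
          simp [this]
      · intro i _ hi
        have : j ≠ i + 1 := by omega
        simp [this]
      · intro hnot
        have hnot' := Finset.mem_range.not.1 hnot
        have : j = j - 1 + 1 := by omega
        simp only [← this, if_true]
        have hz : q.coeff (j - 1) = 0 := coeff_eq_zero_of_natDegree_lt (by omega)
        simp [hz]
  refine ⟨Q, ?_, ?_, ?_⟩
  · ext j
    rw [coeff_derivative, hcoeff (j + 1)]
    simp only [Nat.add_one_ne_zero, if_false, Nat.add_sub_cancel]
    by_cases hlt : j < q.natDegree + 1
    · rw [if_pos hlt]; field_simp
    · rw [if_neg hlt]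
      have : q.coeff j = 0 := coeff_eq_zero_of_natDegree_lt (by omega)
      simp [this]
  · refine (natDegree_le_iff_coeff_eq_zero).2 fun j hj => ?_
    rw [hcoeff j]
    have hj0 : j ≠ 0 := by omega
    rw [if_neg hj0, if_neg (by omega)]
  · intro hq i hi
    rw [hcoeff i]
    rcases Nat.eq_zero_or_pos i with rfl | hi0
    · simp
    · rw [if_neg hi0.ne']
      by_cases hlt : i - 1 < q.natDegree + 1
      · rw [if_pos hlt]
        have : Even (i - 1) := by
          rcases hi with ⟨k, rfl⟩
          exact ⟨k, by omega⟩
        rw [hq _ this]; simp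
      · rw [if_neg hlt]

/-! ### Calculus helpers (gluing, constancy on a half-line, integrals over open intervals) -/

/-- Gluing: a function that agrees with a `C^m` function on `(−∞, b)` and with another one on
`(a, ∞)`, `a < b`, is `C^m`. [folklore] -/
theorem contDiff_of_eqOn_Iio_Ioi {m : ℕ∞} {f g₁ g₂ : ℝ → ℝ} {a b : ℝ} (hab : a < b)
    (h₁ : ContDiff ℝ m g₁) (h₂ : ContDiff ℝ m g₂) (hf₁ : ∀ x, x < b → f x = g₁ x)
    (hf₂ : ∀ x, a < x → f x = g₂ x) : ContDiff ℝ m f := by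
  refine contDiff_iff_contDiffAt.2 fun x => ?_
  rcases lt_or_ge x b with hx | hx
  · have hev : f =ᶠ[𝓝 x] g₁ := Filter.mem_of_superset (Iio_mem_nhds hx) fun y hy => hf₁ y hy
    exact h₁.contDiffAt.congr_of_eventuallyEq hev
  · have hx' : a < x := lt_of_lt_of_le hab hx
    have hev : f =ᶠ[𝓝 x] g₂ := Filter.mem_of_superset (Ioi_mem_nhds hx') fun y hy => hf₂ y hy
    exact h₂.contDiffAt.congr_of_eventuallyEq hev

/-- A differentiable function with zero derivative on `(−∞, R)`, `R > 0`, is constant there.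
[folklore] -/
theorem eq_at_zero_of_deriv_eq_zero_Iio {D : ℝ → ℝ} (hD : Differentiable ℝ D) {R : ℝ} (hR : 0 < R)
    (h : ∀ y, y < R → deriv D y = 0) : ∀ y, y < R → D y = D 0 := by
  intro y hy
  rcases lt_trichotomy y 0 with hlt | heq | hgt
  · obtain ⟨c, hc, hcd⟩ := exists_deriv_eq_slope D hlt hD.continuous.continuousOn
      (hD.differentiableOn)
    rw [h c (by linarith [hc.2])] at hcd
    have hne : (0 : ℝ) - y ≠ 0 := by linarith
    rcases (div_eq_zero_iff.1 hcd.symm) with h0 | h0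
    · linarith
    · exact absurd h0 hne
  · rw [heq]
  · obtain ⟨c, hc, hcd⟩ := exists_deriv_eq_slope D hgt hD.continuous.continuousOn
      (hD.differentiableOn)
    rw [h c (by linarith [hc.2])] at hcd
    have hne : y - 0 ≠ 0 := by linarith
    rcases (div_eq_zero_iff.1 hcd.symm) with h0 | h0
    · linarith
    · exact absurd h0 hne

/-- An interval integral of a function vanishing on the open interval is zero. [folklore] -/
theorem intervalIntegral_eq_zero_of_Ioo {f : ℝ → ℝ} {a b : ℝ} (hab : a ≤ b)
    (h : ∀ x ∈ Ioo a b, f x = 0) : ∫ x in a..b, f x = 0 := by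
  rw [intervalIntegral.integral_of_le hab, integral_Ioc_eq_integral_Ioo]
  exact setIntegral_eq_zero_of_forall_eq_zero h


end Literature.Analysis.ODE
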